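import Summits.ResolutionOfSingularities.ResolutionOfSingularities.Theses.WildQuotients
import Summits.ResolutionOfSingularities.ResolutionOfSingularities.Theorems.PAlterationPialtProjective
import Literature.AlgebraicGeometry.Resolution.AlterationsCompactification
import Literature.AlgebraicGeometry.Resolution.AlterationsResolution
import Literature.AlgebraicGeometry.Resolution.ChowLemmaProofs
import HarnessLib

/-!
# WildQuotients / `GaloisQuotientAlteration` (stmt-ResolutionOfSingularities-16323): reductions of
# the Galois-type quotient presentation — open subschemes, purely inseparable alterations, Chow

Route `ResolutionOfSingularities/WildQuotients`, support item `GaloisQuotientAlteration` (de Jong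
1997, Thm. 5.13 / Cor. 5.15 read through the quotient by a finite group). Write `GQA(X)` for the
body of the item at an integral separated finite-type `k`-scheme `X` (`f : X → Spec k`): a regular
integral `X'` with a finite group `G` acting, a finite surjective generically étale `G`-invariant
`q : X' → X₁` with fibres the `G`-orbits onto an integral `X₁`, and `φ : X₁ → X` proper surjective,
finite and universally injective over a dense open, `X₁` separated of finite type over `k`.

This helper file (`--supports` the item; it does not close it) proves the HYPOTHESIS-FREE
reductions of `GQA`, in the item's own format (no function fields, no affine-open clause):

* `galoisQuotientAlterationAt_of_isOpenImmersion` — `GQA(X̄) ⇒ GQA(X)` for an open immersion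
  `j : X → X̄` of integral schemes: restrict `X₁`, `X'`, `q`, `φ` over `X` (fibre products with
  `j`), the group acting on `X' ×_{X₁} (X₁ ×_{X̄} X)` by functoriality of the fibre product
  (de Jong 1996, 4.7 for alterations; radicial / finite / étale morphisms are stable under base
  change);
* `galoisQuotientAlterationAt_of_isPurelyInseparableAlteration` — `GQA(X̃) ⇒ GQA(X)` along a
  purely inseparable alteration `m : X̃ → X` (in particular a modification, e.g. a Chow cover):
  replace `φ` by `φ ≫ m` (purely inseparable alterations compose, de Jong 1996, 2.20);
* `galoisQuotientAlterationAt_of_forall_isProjectiveOver` — **`GQA` for every integral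
  PROJECTIVE `k`-variety implies `GQA` for every integral separated `k`-scheme of finite type**:
  Chow's lemma in the integral form (`ChowLemmaIntegral_holds`, in tree) gives a modification
  `π : X̃ → X` with an immersion `X̃ ↪ ℙⁿ_k`; apply `GQA` to the projective closure of `X̃`,
  restrict to the open `X̃`, push down along `π`;
* `galoisQuotientAlteration_of_forall_isProjectiveOver`,
  `galoisQuotientAlteration_iff_forall_isProjectiveOver` — the item is equivalent to its
  restriction to projective varieties.

These are the `k`-rational reductions needed to feed de Jong's theorem in its printed setting
(projective varieties) into the item; the companion files descend the Galois alteration datum from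
the perfect closure. Everything here is proved; no named fact is used.
-/

noncomputable section

set_option linter.dupNamespace false -- mandated namespace of this single-conjunct summit

namespace Summit.ResolutionOfSingularities.ResolutionOfSingularities.Theorems

open CategoryTheory CategoryTheory.Limits AlgebraicGeometry TopologicalSpace
open Literature.AlgebraicGeometry.Resolution

universe u

/-! ## Base change of the presentation along an open immersion -/

/-- Étaleness over an open `U` of the target passes to any base change: `X' ×_{X₁} X₁° → X₁°` is
étale over `j₁⁻¹(U)` if `X' → X₁` is étale over `U` (étale morphisms are stable under base change).
[folklore] -/
theorem etale_pullback_snd_morphismRestrict {X' X₁ X₁' : Scheme.{u}} (q : X' ⟶ X₁)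
    (j₁ : X₁' ⟶ X₁) (U : X₁.Opens) [Etale (q ∣_ U)] :
    Etale (pullback.snd q j₁ ∣_ j₁ ⁻¹ᵁ U) := by
  have sq₁ := (isPullback_morphismRestrict (pullback.snd q j₁) (j₁ ⁻¹ᵁ U)).flip
  have sq₂ : IsPullback (pullback.fst q j₁) (pullback.snd q j₁) q j₁ :=
    IsPullback.of_hasPullback _ _
  have big := sq₁.paste_horiz sq₂
  rw [← morphismRestrict_ι] at big
  have sq₃ := (isPullback_morphismRestrict q U).flip
  exact MorphismProperty.of_isPullback (big.of_right' sq₃) inferInstance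

/-- A dense open of an irreducible scheme pulls back to a dense open along an open immersion with
non-empty source. [folklore] -/
theorem dense_preimage_of_isOpenImmersion {X Y : Scheme.{u}} (j : X ⟶ Y) [IsOpenImmersion j]
    [IrreducibleSpace Y] [IrreducibleSpace X] (U : Y.Opens) (hU : Dense (U : Set Y)) :
    Dense ((j ⁻¹ᵁ U : X.Opens) : Set X) := by
  have hjX : (j.opensRange : Set Y).Nonempty := by
    obtain ⟨x⟩ := (inferInstance : Nonempty X)
    exact ⟨j x, x, rfl⟩
  obtain ⟨_, ⟨x, rfl⟩, hxU⟩ := hU.inter_open_nonempty _ j.opensRange.isOpen hjX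
  exact (j ⁻¹ᵁ U).isOpen.dense ⟨x, hxU⟩

/-- **`GQA` passes to open subschemes.** Let `j : X → X̄` be an open immersion of integral schemes,
`X` separated of finite type over `k`. If `X̄` carries a Galois-type quotient presentation
`(X', X₁, q, φ, G, ρ)` (the body of `GaloisQuotientAlteration`, for some structure morphism
`f̄ : X̄ → Spec k`), then so does `X`: take `X₁° = X₁ ×_{X̄} X`, `X'° = X' ×_{X₁} X₁°` with the
induced action, `q°`, `φ°` the second projections. Regularity and integrality pass to the open
subschemes `X'° ⊆ X'`, `X₁° ⊆ X₁`; finiteness, surjectivity, properness, étaleness and radiciality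
are stable under base change; the fibres of `q°` are orbits because `X'° → X'` is injective.
[cite: DeJong1996, 4.7, p. 67] -/
theorem galoisQuotientAlterationAt_of_isOpenImmersion {k : Type u} [Field k] {X Xbar : Scheme.{u}}
    [IsIntegral X] [IsIntegral Xbar] (f : X ⟶ Spec (.of k)) [IsSeparated f] [LocallyOfFiniteType f]
    [QuasiCompact f] (fbar : Xbar ⟶ Spec (.of k)) (j : X ⟶ Xbar) [IsOpenImmersion j]
    (h : ∃ (X' X₁ : Scheme.{u}) (q : X' ⟶ X₁) (φ : X₁ ⟶ Xbar) (G : Type u) (_ : Group G)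
      (_ : Finite G) (ρ : G →* Aut X'), IsSeparated (φ ≫ fbar) ∧ LocallyOfFiniteType (φ ≫ fbar) ∧
      QuasiCompact (φ ≫ fbar) ∧ IsIntegral X₁ ∧ IsIntegral X' ∧ Scheme.IsRegular X' ∧ IsFinite q ∧
      Function.Surjective q.base ∧ (∃ U : X₁.Opens, Dense (U : Set X₁) ∧ Etale (q ∣_ U)) ∧
      (∀ g : G, (ρ g).hom ≫ q = q) ∧
      (∀ x y : X', q.base x = q.base y → ∃ g : G, (ρ g).hom.base x = y) ∧ IsProper φ ∧
      Function.Surjective φ.base ∧ ∃ V : Xbar.Opens, Dense (V : Set Xbar) ∧ IsFinite (φ ∣_ V) ∧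
      UniversallyInjective (φ ∣_ V)) :
    ∃ (X' X₁ : Scheme.{u}) (q : X' ⟶ X₁) (φ : X₁ ⟶ X) (G : Type u) (_ : Group G) (_ : Finite G)
      (ρ : G →* Aut X'), IsSeparated (φ ≫ f) ∧ LocallyOfFiniteType (φ ≫ f) ∧
      QuasiCompact (φ ≫ f) ∧ IsIntegral X₁ ∧ IsIntegral X' ∧ Scheme.IsRegular X' ∧ IsFinite q ∧
      Function.Surjective q.base ∧ (∃ U : X₁.Opens, Dense (U : Set X₁) ∧ Etale (q ∣_ U)) ∧
      (∀ g : G, (ρ g).hom ≫ q = q) ∧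
      (∀ x y : X', q.base x = q.base y → ∃ g : G, (ρ g).hom.base x = y) ∧ IsProper φ ∧
      Function.Surjective φ.base ∧ ∃ V : X.Opens, Dense (V : Set X) ∧ IsFinite (φ ∣_ V) ∧
      UniversallyInjective (φ ∣_ V) := by
  obtain ⟨X', X₁, q, φ, G, _, _, ρ, -, -, -, hX₁, hX', hreg, hqfin, hqsurj, ⟨U, hU, hUet⟩, hinv,
    horb, hφprop, hφsurj, V, hV, hVfin, hVui⟩ := h
  haveI := hX₁; haveI := hX'; haveI := hqfin; haveI := hφprop; haveI := hUet
  -- `φ` is a purely inseparable alteration, and so is its restriction `φ°` over `X`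
  have hφpi : IsPurelyInseparableAlteration φ :=
    ⟨hX₁, hφprop, ⟨hφsurj.denseRange⟩, V, hV.nonempty, hVfin, hVui⟩
  have hφ' := isPurelyInseparableAlteration_pullback_snd_of_isOpenImmersion φ j hφpi
  haveI : IsIntegral (pullback φ j) := hφ'.isIntegral
  haveI : IsProper (pullback.snd φ j) := hφ'.isProper
  -- `q` is an alteration (finite surjective from an integral scheme), and so is `q°`
  have hqalt : IsAlteration q := by
    refine ⟨hX', inferInstance, ⟨hqsurj.denseRange⟩, ⊤, ?_, ?_⟩
    · obtain ⟨x⟩ := (inferInstance : Nonempty X₁)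
      exact ⟨x, trivial⟩
    · exact MorphismProperty.of_isPullback (isPullback_morphismRestrict q ⊤).flip hqfin
  have hq' := hqalt.pullback_snd_of_isOpenImmersion q (pullback.fst φ j)
  haveI : IsIntegral (pullback q (pullback.fst φ j)) := hq'.isIntegral
  -- notation
  let X₁' := pullback φ j
  let φ' : X₁' ⟶ X := pullback.snd φ j
  let j₁ : X₁' ⟶ X₁ := pullback.fst φ j
  let X'' := pullback q j₁
  let q' : X'' ⟶ X₁' := pullback.snd q j₁
  let j' : X'' ⟶ X' := pullback.fst q j₁
  -- the induced action on `X'' = X' ×_{X₁} X₁°`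
  have hcomm : ∀ g : G, q ≫ 𝟙 X₁ = (ρ g).hom ≫ q := fun g => by rw [Category.comp_id, hinv]
  let a : G → (X'' ⟶ X'') := fun g =>
    pullback.map q j₁ q j₁ (ρ g).hom (𝟙 _) (𝟙 _) (hcomm g) (by simp)
  have ha_fst : ∀ g, a g ≫ j' = j' ≫ (ρ g).hom := fun g => pullback.lift_fst _ _ _
  have ha_snd : ∀ g, a g ≫ q' = q' := fun g => by
    change pullback.map _ _ _ _ _ _ _ _ _ ≫ pullback.snd _ _ = _
    rw [pullback.lift_snd, Category.comp_id]
  have ha_one : a 1 = 𝟙 _ := by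
    apply pullback.hom_ext
    · rw [ha_fst, map_one, Category.id_comp]; rfl
    · rw [ha_snd, Category.id_comp]
  have ha_mul : ∀ g h : G, a (g * h) = a h ≫ a g := fun g h => by
    apply pullback.hom_ext
    · rw [ha_fst, Category.assoc, ha_fst, reassoc_of% (ha_fst h), map_mul, Aut.Aut_mul_def]
      rfl
    · rw [ha_snd, Category.assoc, ha_snd, ha_snd]
  let ι : G → Aut X'' := fun g =>
    { hom := a g
      inv := a g⁻¹
      hom_inv_id := by rw [← ha_mul, inv_mul_cancel, ha_one]
      inv_hom_id := by rw [← ha_mul, mul_inv_cancel, ha_one] }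
  let ρ' : G →* Aut X'' := MonoidHom.mk' ι fun g h => by
    ext : 1
    change a (g * h) = a h ≫ a g
    exact ha_mul g h
  have hρ' : ∀ g, (ρ' g).hom = a g := fun _ => rfl
  -- the dense opens
  have hU' : Dense ((j₁ ⁻¹ᵁ U : X₁'.Opens) : Set X₁') := dense_preimage_of_isOpenImmersion j₁ U hU
  obtain ⟨V', hV', hV'fin, hV'ui⟩ := hφ'.exists_dense
  refine ⟨X'', X₁', q', φ', G, inferInstance, inferInstance, ρ', inferInstance, inferInstance,
    inferInstance, inferInstance, inferInstance,
    Scheme.IsRegular.of_isOpenImmersion j' hreg, MorphismProperty.pullback_snd _ _ hqfin,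
    (MorphismProperty.pullback_snd (P := @Surjective) _ _ ⟨hqsurj⟩).1,
    ⟨j₁ ⁻¹ᵁ U, hU', etale_pullback_snd_morphismRestrict q j₁ U⟩, fun g => ?_, ?_, inferInstance,
    (hφ'.surjective).1, V', hV', hV'fin, hV'ui⟩
  · rw [hρ']; exact ha_snd g
  · intro x y hxy
    have hq : q.base (j'.base x) = q.base (j'.base y) := by
      change (j' ≫ q).base x = (j' ≫ q).base y
      rw [pullback.condition]
      change j₁.base (q'.base x) = j₁.base (q'.base y)
      rw [hxy]
    obtain ⟨g, hg⟩ := horb _ _ hq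
    refine ⟨g, j'.isOpenEmbedding.injective ?_⟩
    change ((ρ' g).hom ≫ j').base x = j'.base y
    rw [hρ', ha_fst]
    exact hg

/-! ## Descent along purely inseparable alterations (modifications, Chow covers) -/

/-- **`GQA` descends along purely inseparable alterations.** If `m : X̃ → X` is a purely
inseparable alteration of integral schemes (e.g. a modification) and `X̃`, with structure morphism
`m ≫ f`, carries a Galois-type quotient presentation `(X', X₁, q, φ, G, ρ)`, then `(X', X₁, q,
φ ≫ m, G, ρ)` is one of `X`: purely inseparable alterations compose (de Jong 1996, 2.20; Temkin
2013, §1.3). [cite: DeJong1996, 2.20, p. 61] -/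
theorem galoisQuotientAlterationAt_of_isPurelyInseparableAlteration {k : Type u} [Field k]
    {X Y : Scheme.{u}} [IsIntegral X] (f : X ⟶ Spec (.of k)) (m : Y ⟶ X)
    (hm : IsPurelyInseparableAlteration m) (fY : Y ⟶ Spec (.of k)) (hfY : m ≫ f = fY)
    (h : ∃ (X' X₁ : Scheme.{u}) (q : X' ⟶ X₁) (φ : X₁ ⟶ Y) (G : Type u) (_ : Group G)
      (_ : Finite G) (ρ : G →* Aut X'), IsSeparated (φ ≫ fY) ∧ LocallyOfFiniteType (φ ≫ fY) ∧
      QuasiCompact (φ ≫ fY) ∧ IsIntegral X₁ ∧ IsIntegral X' ∧ Scheme.IsRegular X' ∧ IsFinite q ∧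
      Function.Surjective q.base ∧ (∃ U : X₁.Opens, Dense (U : Set X₁) ∧ Etale (q ∣_ U)) ∧
      (∀ g : G, (ρ g).hom ≫ q = q) ∧
      (∀ x y : X', q.base x = q.base y → ∃ g : G, (ρ g).hom.base x = y) ∧ IsProper φ ∧
      Function.Surjective φ.base ∧ ∃ V : Y.Opens, Dense (V : Set Y) ∧ IsFinite (φ ∣_ V) ∧
      UniversallyInjective (φ ∣_ V)) :
    ∃ (X' X₁ : Scheme.{u}) (q : X' ⟶ X₁) (φ : X₁ ⟶ X) (G : Type u) (_ : Group G) (_ : Finite G)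
      (ρ : G →* Aut X'), IsSeparated (φ ≫ f) ∧ LocallyOfFiniteType (φ ≫ f) ∧
      QuasiCompact (φ ≫ f) ∧ IsIntegral X₁ ∧ IsIntegral X' ∧ Scheme.IsRegular X' ∧ IsFinite q ∧
      Function.Surjective q.base ∧ (∃ U : X₁.Opens, Dense (U : Set X₁) ∧ Etale (q ∣_ U)) ∧
      (∀ g : G, (ρ g).hom ≫ q = q) ∧
      (∀ x y : X', q.base x = q.base y → ∃ g : G, (ρ g).hom.base x = y) ∧ IsProper φ ∧
      Function.Surjective φ.base ∧ ∃ V : X.Opens, Dense (V : Set X) ∧ IsFinite (φ ∣_ V) ∧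
      UniversallyInjective (φ ∣_ V) := by
  obtain ⟨X', X₁, q, φ, G, _, _, ρ, hs, hl, hq, hX₁, hX', hreg, hqfin, hqsurj, hUet, hinv,
    horb, hφprop, hφsurj, V, hV, hVfin, hVui⟩ := h
  haveI := hX₁; haveI := hm.isIntegral; haveI := hm.isProper
  have hφpi : IsPurelyInseparableAlteration φ :=
    ⟨hX₁, hφprop, ⟨hφsurj.denseRange⟩, V, hV.nonempty, hVfin, hVui⟩
  have hc : IsPurelyInseparableAlteration (φ ≫ m) := hφpi.comp hm
  haveI := hc.isProper
  subst hfY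
  refine ⟨X', X₁, q, φ ≫ m, G, inferInstance, inferInstance, ρ, ?_, ?_, ?_, hX₁, hX', hreg, hqfin,
    hqsurj, hUet, hinv, horb, inferInstance, (hc.surjective).1, hc.exists_dense⟩
  · simpa only [Category.assoc] using hs
  · simpa only [Category.assoc] using hl
  · simpa only [Category.assoc] using hq

/-! ## Reduction to projective varieties -/

/-- **`GQA` for projective varieties over `k` implies `GQA` for every integral separated
`k`-scheme of finite type.** Chow's lemma in the integral form (`ChowLemmaIntegral_holds`) gives a
proper birational `π : X̃ → X` from an integral `X̃` with an immersion `ι : X̃ → ℙⁿ_k` over `k`;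
the scheme-theoretic image `X̄` of `ι` is an integral projective `k`-variety containing `X̃` as an
open subscheme; `GQA(X̄)` restricts to `X̃` (`galoisQuotientAlterationAt_of_isOpenImmersion`) and
descends along the modification `π` (`galoisQuotientAlterationAt_of_isPurelyInseparableAlteration`).
[cite: DeJong1996, 4.6–4.7, pp. 66–67] -/
theorem galoisQuotientAlterationAt_of_forall_isProjectiveOver {k : Type u} [Field k]
    {X : Scheme.{u}} (f : X ⟶ Spec (.of k)) [IsSeparated f] [LocallyOfFiniteType f]
    [QuasiCompact f] [IsIntegral X]
    (H : ∀ (Y : Scheme.{u}) (g : Y ⟶ Spec (.of k)), IsIntegral Y →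
      Literature.AlgebraicGeometry.Motives.IsProjectiveOver (Over.mk g) →
      ∃ (X' X₁ : Scheme.{u}) (q : X' ⟶ X₁) (φ : X₁ ⟶ Y) (G : Type u) (_ : Group G)
        (_ : Finite G) (ρ : G →* Aut X'), IsSeparated (φ ≫ g) ∧ LocallyOfFiniteType (φ ≫ g) ∧
        QuasiCompact (φ ≫ g) ∧ IsIntegral X₁ ∧ IsIntegral X' ∧ Scheme.IsRegular X' ∧ IsFinite q ∧
        Function.Surjective q.base ∧ (∃ U : X₁.Opens, Dense (U : Set X₁) ∧ Etale (q ∣_ U)) ∧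
        (∀ g : G, (ρ g).hom ≫ q = q) ∧
        (∀ x y : X', q.base x = q.base y → ∃ g : G, (ρ g).hom.base x = y) ∧ IsProper φ ∧
        Function.Surjective φ.base ∧ ∃ V : Y.Opens, Dense (V : Set Y) ∧ IsFinite (φ ∣_ V) ∧
        UniversallyInjective (φ ∣_ V)) :
    ∃ (X' X₁ : Scheme.{u}) (q : X' ⟶ X₁) (φ : X₁ ⟶ X) (G : Type u) (_ : Group G) (_ : Finite G)
      (ρ : G →* Aut X'), IsSeparated (φ ≫ f) ∧ LocallyOfFiniteType (φ ≫ f) ∧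
      QuasiCompact (φ ≫ f) ∧ IsIntegral X₁ ∧ IsIntegral X' ∧ Scheme.IsRegular X' ∧ IsFinite q ∧
      Function.Surjective q.base ∧ (∃ U : X₁.Opens, Dense (U : Set X₁) ∧ Etale (q ∣_ U)) ∧
      (∀ g : G, (ρ g).hom ≫ q = q) ∧
      (∀ x y : X', q.base x = q.base y → ∃ g : G, (ρ g).hom.base x = y) ∧ IsProper φ ∧
      Function.Surjective φ.base ∧ ∃ V : X.Opens, Dense (V : Set X) ∧ IsFinite (φ ∣_ V) ∧
      UniversallyInjective (φ ∣_ V) := by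
  obtain ⟨n, Xt, π, ι, hXt, hι, hπ, hsurj, hcomm, U, hU, hU', hiso⟩ :=
    ChowLemmaIntegral_holds.{u} k X f ‹_› ‹_› ‹_› ‹_›
  haveI := hXt; haveI := hι; haveI := hπ; haveI := hsurj; haveI := hiso
  -- `π` is proper birational, hence a purely inseparable alteration
  have hπpi : IsPurelyInseparableAlteration π :=
    IsBirational.isPurelyInseparableAlteration ⟨U, hU, hU', hiso⟩
  -- the projective closure `X̄` of `X̃` in `ℙⁿ_k`
  let P := Literature.AlgebraicGeometry.Motives.projectiveSpace n k
  haveI : IsProper P.hom := Literature.AlgebraicGeometry.Motives.isProper_projectiveSpace n k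
  haveI : QuasiCompact (ι ≫ P.hom) := by rw [hcomm]; infer_instance
  haveI : QuasiCompact ι := QuasiCompact.of_comp ι P.hom
  haveI : IsIntegral ι.image := ChowLemmaProof.isIntegral_image ι
  -- structure morphism of `X̃` and its properties
  haveI : IsSeparated (π ≫ f) := inferInstance
  haveI : LocallyOfFiniteType (π ≫ f) := inferInstance
  haveI : QuasiCompact (π ≫ f) := inferInstance
  refine galoisQuotientAlterationAt_of_isPurelyInseparableAlteration f π hπpi (π ≫ f) rfl ?_
  refine galoisQuotientAlterationAt_of_isOpenImmersion (π ≫ f) (ι.imageι ≫ P.hom) ι.toImage ?_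
  exact H ι.image (ι.imageι ≫ P.hom) inferInstance
    ⟨n, Over.homMk ι.imageι rfl, inferInstanceAs (IsClosedImmersion ι.imageι)⟩

/-- **The item reduces to projective varieties**: if every integral PROJECTIVE variety over every
field of characteristic `p > 0` admits a Galois-type quotient presentation, then
`GaloisQuotientAlteration` holds (`galoisQuotientAlterationAt_of_forall_isProjectiveOver` at each
`(p, k, X)`). [cite: DeJong1996, 4.6–4.7, pp. 66–67] -/
theorem galoisQuotientAlteration_of_forall_isProjectiveOver
    (H : ∀ p : ℕ, p.Prime → ∀ (k : Type) [Field k] [CharP k p] (Y : Scheme.{0})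
      (g : Y ⟶ Spec (.of k)), IsIntegral Y →
      Literature.AlgebraicGeometry.Motives.IsProjectiveOver (Over.mk g) →
      ∃ (X' X₁ : Scheme.{0}) (q : X' ⟶ X₁) (φ : X₁ ⟶ Y) (G : Type) (_ : Group G)
        (_ : Finite G) (ρ : G →* Aut X'), IsSeparated (φ ≫ g) ∧ LocallyOfFiniteType (φ ≫ g) ∧
        QuasiCompact (φ ≫ g) ∧ IsIntegral X₁ ∧ IsIntegral X' ∧ Scheme.IsRegular X' ∧ IsFinite q ∧
        Function.Surjective q.base ∧ (∃ U : X₁.Opens, Dense (U : Set X₁) ∧ Etale (q ∣_ U)) ∧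
        (∀ g : G, (ρ g).hom ≫ q = q) ∧
        (∀ x y : X', q.base x = q.base y → ∃ g : G, (ρ g).hom.base x = y) ∧ IsProper φ ∧
        Function.Surjective φ.base ∧ ∃ V : Y.Opens, Dense (V : Set Y) ∧ IsFinite (φ ∣_ V) ∧
        UniversallyInjective (φ ∣_ V)) :
    Summit.ResolutionOfSingularities.ResolutionOfSingularities.Theses.WildQuotients.GaloisQuotientAlteration := by
  intro p hp k _ _ X f hs hl hq hi
  haveI := hs; haveI := hl; haveI := hq; haveI := hi
  exact galoisQuotientAlterationAt_of_forall_isProjectiveOver f fun Y g hY hproj =>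
    H p hp k Y g hY hproj

/-- **`GaloisQuotientAlteration` is equivalent to its restriction to projective varieties** over
fields of positive characteristic (a projective variety is separated of finite type over `k`).
[cite: DeJong1996, 4.6–4.7, pp. 66–67] -/
theorem galoisQuotientAlteration_iff_forall_isProjectiveOver :
    Summit.ResolutionOfSingularities.ResolutionOfSingularities.Theses.WildQuotients.GaloisQuotientAlteration ↔
    ∀ p : ℕ, p.Prime → ∀ (k : Type) [Field k] [CharP k p] (Y : Scheme.{0})
      (g : Y ⟶ Spec (.of k)), IsIntegral Y →
      Literature.AlgebraicGeometry.Motives.IsProjectiveOver (Over.mk g) →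
      ∃ (X' X₁ : Scheme.{0}) (q : X' ⟶ X₁) (φ : X₁ ⟶ Y) (G : Type) (_ : Group G)
        (_ : Finite G) (ρ : G →* Aut X'), IsSeparated (φ ≫ g) ∧ LocallyOfFiniteType (φ ≫ g) ∧
        QuasiCompact (φ ≫ g) ∧ IsIntegral X₁ ∧ IsIntegral X' ∧ Scheme.IsRegular X' ∧ IsFinite q ∧
        Function.Surjective q.base ∧ (∃ U : X₁.Opens, Dense (U : Set X₁) ∧ Etale (q ∣_ U)) ∧
        (∀ g : G, (ρ g).hom ≫ q = q) ∧
        (∀ x y : X', q.base x = q.base y → ∃ g : G, (ρ g).hom.base x = y) ∧ IsProper φ ∧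
        Function.Surjective φ.base ∧ ∃ V : Y.Opens, Dense (V : Set Y) ∧ IsFinite (φ ∣_ V) ∧
        UniversallyInjective (φ ∣_ V) := by
  refine ⟨fun h p hp k _ _ Y g hY hproj => ?_, galoisQuotientAlteration_of_forall_isProjectiveOver⟩
  haveI := isProper_of_isProjectiveOver g hproj
  exact h p hp k Y g inferInstance inferInstance inferInstance hY

end Summit.ResolutionOfSingularities.ResolutionOfSingularities.Theorems

end
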